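import Literature.AlgebraicGeometry.Resolution.WeightedResolutionDatum
import Literature.AlgebraicGeometry.Resolution.CobordantBlowupFiltration

/-!
# The extended Rees algebra of a weighted chart is the cobordant algebra

Route `ResolutionOfSingularities/WeightedInvariant`, crux `WeightedConstruction`
(stmt-ResolutionOfSingularities-0571), line `support-first-weights-second`, stub
`stub_extReesAlgebra_weighted` (stub 1a of the lead skeleton).

For a family `u : Fin m → A` with weights `w : Fin m → ℕ` (no positivity needed), the datum file's
extended Rees algebra `extReesAlgebra (weightedMonomialIdeal u w) = A[t⁻¹, 𝒥ₙ tⁿ : n ≥ 1]`,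
`𝒥ₙ = (u^α : Σ wᵢ αᵢ ≥ n)` (`WeightedResolutionDatum.lean`), coincides with the tree's
`cobordantAlgebra u w = A[t⁻¹, uᵢ t^{wᵢ}]` (`CobordantBlowupAlgebra.lean`; Włodarczyk,
arXiv:2203.03090, Lemma 2.1.8 / §2.2.7, compare `cobordantAlgebra_eq_extendedRees`). Both are
`A`-subalgebras of `A[t, t⁻¹]` given by `Algebra.adjoin`, and the proof is `le_antisymm` of two
`Algebra.adjoin_le`:

* `⊆`: `t⁻¹ ∈ A[t⁻¹, uᵢ t^{wᵢ}]`; for a generator `a tⁿ`, `a ∈ 𝒥ₙ`, induct on the span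
  (`a ↦ a tⁿ` is `A`-linear) down to a monomial `a = u^α`, `n ≤ N := Σ wᵢ αᵢ`, where
  `u^α tⁿ = (∏ (uᵢ t^{wᵢ})^{αᵢ}) · t^{-(N - n)}` (`C_prod_pow_mul_T_eq`);
* `⊇`: `t⁻¹` is a generator; `uᵢ t^{wᵢ}` is the generator `a tⁿ` with `a = uᵢ ∈ 𝒥_{wᵢ}`
  (exponent `eᵢ`) when `wᵢ > 0`, and the constant `uᵢ` when `wᵢ = 0`.
-/

set_option linter.dupNamespace false -- mandated namespace of this single-conjunct summit

namespace Summit.ResolutionOfSingularities.ResolutionOfSingularities.Theorems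

open CategoryTheory AlgebraicGeometry TopologicalSpace Literature.AlgebraicGeometry.Resolution
open LaurentPolynomial
open scoped LaurentPolynomial

section Helpers

variable {A : Type} [CommRing A]

/-- `∏ᵢ t^{fᵢ} = t^{Σ fᵢ}` in `A[t, t⁻¹]`. [folklore] -/
theorem extReesWeighted_prod_T {ι : Type} (s : Finset ι) (f : ι → ℤ) :
    ∏ i ∈ s, (T (f i) : A[T;T⁻¹]) = T (∑ i ∈ s, f i) := by
  classical
  induction s using Finset.induction_on with
  | empty => simp
  | insert a s ha ih => rw [Finset.prod_insert ha, Finset.sum_insert ha, ih, ← T_add]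

variable {m : ℕ} (u : Fin m → A) (w : Fin m → ℕ)

/-- `u^α t^{Σ wᵢ αᵢ} = ∏ᵢ (uᵢ t^{wᵢ})^{αᵢ}` in `A[t, t⁻¹]`. [folklore] -/
theorem extReesWeighted_C_prod_pow_mul_T_eq (α : Fin m → ℕ) :
    C (∏ i, u i ^ α i) * T ((∑ i, w i * α i : ℕ) : ℤ) =
      ∏ i, (C (u i) * T (w i : ℤ)) ^ (α i) := by
  simp_rw [mul_pow, ← map_pow, T_pow, Finset.prod_mul_distrib, ← map_prod, extReesWeighted_prod_T]
  congr 2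
  push_cast
  exact Finset.sum_congr rfl fun i _ => mul_comm _ _

/-- `u^α t^{Σ wᵢ αᵢ} ∈ A[t⁻¹, uᵢ t^{wᵢ}]`. [folklore] -/
theorem extReesWeighted_C_prod_pow_mul_T_mem (α : Fin m → ℕ) :
    C (∏ i, u i ^ α i) * T ((∑ i, w i * α i : ℕ) : ℤ) ∈ cobordantAlgebra u w := by
  rw [extReesWeighted_C_prod_pow_mul_T_eq]
  exact Subalgebra.prod_mem _ fun i _ =>
    Subalgebra.pow_mem _ (cobordantAlgebra.C_mul_T_mem u w i) _

/-- For `a ∈ 𝒥ₙ = (u^α : Σ wᵢ αᵢ ≥ n)`, `a tⁿ ∈ A[t⁻¹, uᵢ t^{wᵢ}]`. [folklore] -/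
theorem extReesWeighted_C_mul_T_mem_of_mem {n : ℕ} {a : A}
    (ha : a ∈ weightedMonomialIdeal u w n) :
    C a * T (n : ℤ) ∈ cobordantAlgebra u w := by
  refine Submodule.span_induction (p := fun a _ => C a * T (n : ℤ) ∈ cobordantAlgebra u w)
    ?_ ?_ ?_ ?_ ha
  · rintro _ ⟨α, hα, rfl⟩
    have e : C (∏ i, u i ^ α i) * T (n : ℤ) =
        C (∏ i, u i ^ α i) * T ((∑ i, w i * α i : ℕ) : ℤ) *
          T (-((∑ i, w i * α i - n : ℕ) : ℤ)) := by
      rw [mul_assoc, ← T_add]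
      congr 2
      push_cast [hα]
      ring
    rw [e]
    exact mul_mem (extReesWeighted_C_prod_pow_mul_T_mem u w α)
      (cobordantAlgebra.T_neg_natCast_mem u w _)
  · rw [map_zero, zero_mul]
    exact Subalgebra.zero_mem _
  · intro a b _ _ ha hb
    rw [map_add, add_mul]
    exact Subalgebra.add_mem _ ha hb
  · intro r a _ ha
    rw [smul_eq_mul, map_mul, mul_assoc]
    exact Subalgebra.mul_mem _ (by rw [C_eq_algebraMap]; exact Subalgebra.algebraMap_mem _ r) ha

/-- `uᵢ ∈ 𝒥_{wᵢ}` (exponent `eᵢ`). [folklore] -/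
theorem extReesWeighted_u_mem_weightedMonomialIdeal (i : Fin m) :
    u i ∈ weightedMonomialIdeal u w (w i) := by
  refine Ideal.subset_span ⟨Pi.single i 1, ?_, ?_⟩
  · rw [Finset.sum_eq_single i (fun j _ hj => by simp [hj])
      (fun hi => absurd (Finset.mem_univ i) hi)]
    simp
  · rw [Finset.prod_eq_single i (fun j _ hj => by simp [hj])
      (fun hi => absurd (Finset.mem_univ i) hi)]
    simp

/-- The generator `uᵢ t^{wᵢ}` of the cobordant algebra lies in the extended Rees algebra of the
weighted monomial ideals (for `wᵢ = 0` it is the constant `uᵢ`). [folklore] -/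
theorem extReesWeighted_C_mul_T_mem_extReesAlgebra (i : Fin m) :
    C (u i) * T (w i : ℤ) ∈ extReesAlgebra (weightedMonomialIdeal u w) := by
  rcases Nat.eq_zero_or_pos (w i) with h | h
  · rw [h, Nat.cast_zero, T_zero, mul_one, C_eq_algebraMap]
    exact Subalgebra.algebraMap_mem _ _
  · exact extReesAlgebra.C_mul_T_mem (I := weightedMonomialIdeal u w) h
      (extReesWeighted_u_mem_weightedMonomialIdeal u w i)

end Helpers

/-- **Stub 1a (bridge to the tree's cobordant algebra).** For any family `u : Fin m → A` and
weights `w`, the datum file's extended Rees algebra of the weighted monomial ideals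
`(u^α : Σ wᵢ αᵢ ≥ n)` IS the tree's `cobordantAlgebra u w = A[t⁻¹, uᵢ t^{wᵢ}]` (both are
`A`-subalgebras of `A[t, t⁻¹]`; Włodarczyk Lemma 2.1.8 / §2.2.7; compare
`cobordantAlgebra_eq_extendedRees`). No positivity of the weights is needed. [folklore] -/
theorem stub_extReesAlgebra_weighted :
    ∀ {A : Type} [CommRing A] {m : ℕ} (u : Fin m → A) (w : Fin m → ℕ),
      extReesAlgebra (weightedMonomialIdeal u w) = cobordantAlgebra u w := by
  intro A _ m u w
  apply le_antisymm
  · refine Algebra.adjoin_le ?_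
    rintro _ (rfl | ⟨n, _, a, ha, rfl⟩)
    · exact cobordantAlgebra.T_neg_one_mem u w
    · exact extReesWeighted_C_mul_T_mem_of_mem u w ha
  · refine Algebra.adjoin_le ?_
    rintro _ (rfl | ⟨i, rfl⟩)
    · exact (extReesAlgebra.tInv (weightedMonomialIdeal u w)).2
    · exact extReesWeighted_C_mul_T_mem_extReesAlgebra u w i

end Summit.ResolutionOfSingularities.ResolutionOfSingularities.Theorems
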